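import Summits.ABC.ABC.Theorems.FeketeScalesAssembly
import Summits.ABC.ABC.Theorems.FeketeScalesTargetOfSubPowerSlack
import Summits.ABC.ABC.Theorems.FeketeScalesSubmultOfRSTBridge

/-!
# Route `FeketeScales`, crux `Target` (stmt-ABC-2159): logical position by name

Calibration lemmas for the crux `Summit.ABC.ABC.Theses.FeketeScales.Target`
(`= ScaleSubmultiplicativity ∧ SparseGoodScales`, definitionally), landed `--supports stmt-ABC-2159`
by the line lead (line `SketchIdeator2`, ω-split):

* `Target.abc_of_target : Target → ABC` — the route's Assembly applied to the two conjuncts: every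
  skeleton of this crux contains a proof of abc.
* `Target.target_iff_scaleSubmultiplicativity_and_abc : Target ↔ ScaleSubmultiplicativity ∧ ABC`
  — under conjunct 1 the second conjunct IS abc (cf.
  `sparseGoodScales_iff_abc_of_scaleSubmultiplicativity` in
  `FeketeScalesSparseGoodScalesWindow.lean`); the content of the crux beyond abc is exactly scale
  sub-multiplicativity.
* `calib_ultraCompositeTail_of_subPowerSlack` (registered calibration sub-goal of the line) /
  `Target.ultraCompositeTail_of_rstConjectureAUpper`
  — the line's registered stub `stub_ultraCompositeTail` (sub-power excess on the tail
  `ω(abc) > (log rad)^θ′`) is a weakening of the pointwise sub-power slack, hence implied by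
  Robert–Stewart–Tenenbaum's Conjecture A (upper half), taken as a hypothesis.
-/

-- `Summit.<Summit>.<Problem>` is the mandated summit-side namespace (CONVENTIONS §2); for the
-- single-conjunct summit `ABC` the two coincide, so the duplicate `ABC.ABC` is deliberate.
set_option linter.dupNamespace false

namespace Summit.ABC.ABC.Theorems

open Literature.NumberTheory.DiophantineGeometry Literature.Barriers.ABC
open Summit.ABC.ABC.Theses.FeketeScales

/-- **The crux implies abc.**  `Target → ABC`: the route's Assembly
(`feketeScales_assembly_proof : ScaleSubmultiplicativity → SparseGoodScales → ABC`, the Fekete-type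
upgrade) applied to the two conjuncts of `Target`. [folklore] -/
theorem Target.abc_of_target (h : Target) : _root_.ABC :=
  feketeScales_assembly_proof h.1 h.2

/-- **Logical position of the crux.**  `Target ↔ ScaleSubmultiplicativity ∧ ABC`: the crux is abc
together with the sub-multiplicativity of the extremal height across radical scales; its content
beyond abc is exactly conjunct 1 (which is implied by Robert–Stewart–Tenenbaum's Conjecture A, upper
half — `SubmultOfRST.scaleSubmultiplicativity_of_rstConjectureAUpper` — and is not known to follow
from abc). [folklore] -/
theorem Target.target_iff_scaleSubmultiplicativity_and_abc :
    Target ↔ (ScaleSubmultiplicativity ∧ _root_.ABC) :=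
  ⟨fun h => ⟨h.1, feketeScales_assembly_proof h.1 h.2⟩,
    fun h => ⟨h.1, Target.sparseGoodScales_of_abc h.2⟩⟩

/-- **The tail stub is a weakening of the pointwise sub-power slack.**  If for some `τ < 1` and some
real `A` every abc triple has `c < rad · exp(A (log rad)^τ)`, then the line's registered stub
`stub_ultraCompositeTail` holds, with `θ = (1 + max τ 0)/2`, `θ′ = θ/2` and
`A′ = |A| max(1, (log 2)^τ) / log 2`: by `SubmultOfRST.slack_le` (at `P = rad`)
`A (log rad)^τ ≤ B (log rad)^{max τ 0}` with `B = |A| max(1,(log 2)^τ)`, and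
`(log rad)^{max τ 0} ≤ (log rad)^θ / log 2` because either `log rad ≥ 1` (monotone exponent) or
`log 2 ≤ log rad < 1` (then `(log rad)^{max τ 0} ≤ 1` and `(log rad)^θ ≥ log rad ≥ log 2`); the
hypothesis on `ω(abc)` is not used. [folklore] -/
theorem calib_ultraCompositeTail_of_subPowerSlack : (∃ τ : ℝ, τ < 1 ∧ ∃ A : ℝ, ∀ a b c : ℕ, Literature.NumberTheory.DiophantineGeometry.IsABCTriple a b c → (c : ℝ) < ((Literature.NumberTheory.DiophantineGeometry.rad a b c : ℕ) : ℝ) * Real.exp (A * Real.log ((Literature.NumberTheory.DiophantineGeometry.rad a b c : ℕ) : ℝ) ^ τ)) → ∃ θ' θ : ℝ, 0 < θ' ∧ θ' < θ ∧ θ < 1 ∧ ∃ A : ℝ, ∀ a b c : ℕ, Literature.NumberTheory.DiophantineGeometry.IsABCTriple a b c → Real.log ((Literature.NumberTheory.DiophantineGeometry.rad a b c : ℕ) : ℝ) ^ θ' < ((ArithmeticFunction.cardDistinctFactors (a * b * c) : ℕ) : ℝ) → (c : ℝ) < ((Literature.NumberTheory.DiophantineGeometry.rad a b c : ℕ) :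 ℝ) * Real.exp (A * Real.log ((Literature.NumberTheory.DiophantineGeometry.rad a b c : ℕ) : ℝ) ^ θ) := by
  intro h
  obtain ⟨τ, hτ1, A, h⟩ := h
  set t : ℝ := max τ 0 with ht_def
  have ht0 : 0 ≤ t := le_max_right _ _
  have ht1 : t < 1 := max_lt hτ1 one_pos
  set θ : ℝ := (1 + t) / 2 with hθ_def
  have hθt : t < θ := by rw [hθ_def]; linarith
  have hθ0 : 0 < θ := lt_of_le_of_lt ht0 hθt
  have hθ1 : θ < 1 := by rw [hθ_def]; linarith
  set B : ℝ := |A| * max 1 (Real.log 2 ^ τ) with hB_def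
  have hB0 : 0 ≤ B := mul_nonneg (abs_nonneg A) (le_trans zero_le_one (le_max_left _ _))
  have hlog2 : 0 < Real.log 2 := Real.log_pos one_lt_two
  have hlog2' : Real.log 2 < 1 := by
    have := Real.log_two_lt_d9; linarith
  refine ⟨θ / 2, θ, by linarith, by linarith, hθ1, B / Real.log 2, ?_⟩
  intro a b c habc _hω
  have hrad2 : (2 : ℝ) ≤ ((rad a b c : ℕ) : ℝ) := by exact_mod_cast SubmultOfRST.two_le_rad habc
  have hlogr : Real.log 2 ≤ Real.log ((rad a b c : ℕ) : ℝ) := Real.log_le_log two_pos hrad2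
  have hlogr0 : 0 < Real.log ((rad a b c : ℕ) : ℝ) := hlog2.trans_le hlogr
  -- step 1: `A (log rad)^τ ≤ B (log rad)^t`
  have h1 : A * Real.log ((rad a b c : ℕ) : ℝ) ^ τ ≤ B * Real.log ((rad a b c : ℕ) : ℝ) ^ t := by
    have := SubmultOfRST.slack_le (τ := τ) (A := A) habc le_rfl
    simpa [hB_def, ht_def] using this
  -- step 2: `(log rad)^t ≤ (log rad)^θ / log 2`
  have h2 : Real.log ((rad a b c : ℕ) : ℝ) ^ t ≤ Real.log ((rad a b c : ℕ) : ℝ) ^ θ / Real.log 2 := by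
    rw [le_div_iff₀ hlog2]
    rcases le_or_gt 1 (Real.log ((rad a b c : ℕ) : ℝ)) with hL | hL
    · calc Real.log ((rad a b c : ℕ) : ℝ) ^ t * Real.log 2
            ≤ Real.log ((rad a b c : ℕ) : ℝ) ^ t * 1 :=
              mul_le_mul_of_nonneg_left hlog2'.le (Real.rpow_nonneg hlogr0.le _)
        _ = Real.log ((rad a b c : ℕ) : ℝ) ^ t := mul_one _
        _ ≤ Real.log ((rad a b c : ℕ) : ℝ) ^ θ := Real.rpow_le_rpow_of_exponent_le hL hθt.le
    · have hle1 : Real.log ((rad a b c : ℕ) : ℝ) ^ t ≤ 1 :=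
        Real.rpow_le_one hlogr0.le hL.le ht0
      have hge : Real.log ((rad a b c : ℕ) : ℝ) ≤ Real.log ((rad a b c : ℕ) : ℝ) ^ θ := by
        have := Real.rpow_le_rpow_of_exponent_ge hlogr0 hL.le hθ1.le
        simpa using this
      calc Real.log ((rad a b c : ℕ) : ℝ) ^ t * Real.log 2 ≤ 1 * Real.log 2 :=
            mul_le_mul_of_nonneg_right hle1 hlog2.le
        _ = Real.log 2 := one_mul _
        _ ≤ Real.log ((rad a b c : ℕ) : ℝ) := hlogr
        _ ≤ Real.log ((rad a b c : ℕ) : ℝ) ^ θ := hge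
  have h3 : A * Real.log ((rad a b c : ℕ) : ℝ) ^ τ
      ≤ B / Real.log 2 * Real.log ((rad a b c : ℕ) : ℝ) ^ θ := by
    calc A * Real.log ((rad a b c : ℕ) : ℝ) ^ τ ≤ B * Real.log ((rad a b c : ℕ) : ℝ) ^ t := h1
      _ ≤ B * (Real.log ((rad a b c : ℕ) : ℝ) ^ θ / Real.log 2) :=
          mul_le_mul_of_nonneg_left h2 hB0
      _ = B / Real.log 2 * Real.log ((rad a b c : ℕ) : ℝ) ^ θ := by ring
  calc (c : ℝ) < ((rad a b c : ℕ) : ℝ) * Real.exp (A * Real.log ((rad a b c : ℕ) : ℝ) ^ τ) :=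
      h a b c habc
    _ ≤ ((rad a b c : ℕ) : ℝ) * Real.exp (B / Real.log 2 * Real.log ((rad a b c : ℕ) : ℝ) ^ θ) :=
      mul_le_mul_of_nonneg_left (Real.exp_le_exp.mpr h3) (Nat.cast_nonneg _)

/-- **The tail stub is implied by Robert–Stewart–Tenenbaum's Conjecture A (upper half).**
Conditional on the open conjecture `RSTConjectureAUpper`, taken as a hypothesis: it gives the
pointwise slack with `τ = 1/2` (`SubmultOfRST.subpowerSlack_of_rstConjectureAUpper`), whence the
registered stub `stub_ultraCompositeTail` of line `SketchIdeator2` by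
`calib_ultraCompositeTail_of_subPowerSlack` [cite: RobertStewartTenenbaum2014, Conjecture A, §1]. -/
theorem Target.ultraCompositeTail_of_rstConjectureAUpper (h : RSTConjectureAUpper) :
    ∃ θ' θ : ℝ, 0 < θ' ∧ θ' < θ ∧ θ < 1 ∧ ∃ A : ℝ, ∀ a b c : ℕ, IsABCTriple a b c →
      Real.log ((rad a b c : ℕ) : ℝ) ^ θ' < ((ArithmeticFunction.cardDistinctFactors (a * b * c) : ℕ) : ℝ) →
      (c : ℝ) < ((rad a b c : ℕ) : ℝ) * Real.exp (A * Real.log ((rad a b c : ℕ) : ℝ) ^ θ) :=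
  calib_ultraCompositeTail_of_subPowerSlack (SubmultOfRST.subpowerSlack_of_rstConjectureAUpper h)

end Summit.ABC.ABC.Theorems
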